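import Mathlib.Analysis.Matrix.Spectrum
import Mathlib.Analysis.InnerProductSpace.PiL2
import Literature.Analysis.InnerProduct.WeinsteinBound
import Literature.Analysis.Matrix.KyFanMaximumPrinciple
import Summits.Ventures.YMGap.FlowData.KWeightTailTheorem
import HarnessLib

/-!
# Matrix-free level certificate: a residual ball plus level isolation gives an index-wise enclosure

HONEST FRAMING: pure finite-dimensional linear algebra over `ℝ` (Mathlib's antitone enumeration
`Matrix.IsHermitian.eigenvalues₀`, largest first).  It is the certificate step a MATRIX-FREE (Lanczos /
LOBPCG, CPU or GPU) eigenvalue of a kept-set transfer-matrix block needs and that no dense certificate of the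
Y3 FLOW-DATA track supplies: the iterative solver never holds the matrix, so no `LDLᵀ` inertia count is
available; what it CAN deliver is a trial pair `(μ, x)` and a rigorously bounded residual
`‖S_T x − μ x‖ ≤ ρ ‖x‖` (float residual + interval / a-priori rounding bound + the operator-norm bound of the
character truncation of the applied factors, `residual_norm_le_of_approx`).  Weinstein's inequality (tree:
`Literature.Analysis.InnerProduct.exists_abs_eigenvalues_sub_mul_norm_le`, Horn–Johnson Thm 6.3.14) then puts
SOME eigenvalue in `[μ − ρ, μ + ρ]`, but not WHICH one.  The index is recovered by ISOLATION: if every level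
above index `k` is certified `> μ + ρ` and every level below index `k` is certified `< μ − ρ` (for the
antitone enumeration only the two neighbours `k − 1`, `k + 1` need checking), the eigenvalue in the ball is
`λ↓_k`.  In the intended use the separating bounds come from a COARSE dense certified point of the same object
(its index-wise upper ends bound the fine kept-set block from above through the lower half of the tail theorem
`KWeightTail.eigenvalues₀_compressed_le`) and from Rayleigh–Ritz lower bounds of the fine run; the final
object-`W` enclosure adds the FINE kept-set tail `κ·Ω` on the upper side only
(`KWeightTail.eigenvalues₀_le_compressed_add`).  Nothing here is a lattice, continuum or Clay statement; which
numbers a given run feeds these hypotheses is the run's audit witness, not a theorem.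

Main results (namespace `Summit.Ventures.YMGap.FlowData.MatrixFreeLevel`):
* `mem_Icc_of_exists_mem_of_isolated`, `forall_lt_of_antitone_of_succ_lt`,
  `forall_gt_of_antitone_of_pred_gt` — isolation of one term of an (antitone) finite sequence;
* `exists_abs_eigenvalues₀_sub_le_of_norm_le`, `…_of_sum_sq_le` — Weinstein's ball for `eigenvalues₀` at any
  trial value, operator-norm and checker (sum-of-squares) shapes; `residual_norm_le_of_approx` — the residual of
  the TRUE matrix from the residual of the APPLIED (truncated) matrix plus a matvec-error bound;
* `eigenvalues₀_mem_Icc_of_residual_of_isolated`, `…_of_neighbours` — THE LEVEL CERTIFICATE for a real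
  symmetric matrix; `eigenvalues₀_zero_mem_Icc_of_residual` (top level), `lt_eigenvalues₀_zero_of_rayleigh` +
  `eigenvalues₀_one_mem_Icc_of_residual_of_rayleigh` (second level, the top separated by a Rayleigh quotient);
* `full_eigenvalues₀_mem_Icc_of_compressed_residual`, `full_eigenvalues₀_zero_mem_Icc_of_compressed_residual`,
  `full_eigenvalues₀_mem_Icc_of_compressed_residual_of_full_lower` — the chain for the K-weight kept-set
  compression `S_T = D_T V D_T` of `S = D V D` (`V ⪰ 0`, FLOW-DATA object `W = W_S + κΩ` on the upper side):
  a fine residual ball isolated by certified bounds ⇒ `λ↓_k(S) ∈ [μ − ρ, μ + ρ + κΩ]`.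

## References
* [HornJohnson2013] R. A. Horn, C. R. Johnson, *Matrix Analysis*, 2nd ed., CUP 2013 — Thm 6.3.14 (Weinstein /
  Bauer–Fike for normal matrices), Thm 4.3.1 (Weyl), Cor. 4.3.37 / Thm 4.3.28 (interlacing for compressions).
* [Parlett1998] B. N. Parlett, *The Symmetric Eigenvalue Problem*, SIAM Classics 20, 1998 — §4.5 (residual
  norm bounds), §11 (Lanczos), §10 (Kato–Temple / gap-based refinements; not used here).
-/

noncomputable section

open scoped InnerProductSpace
open Matrix WithLp

namespace Summit.Ventures.YMGap.FlowData

namespace MatrixFreeLevel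

/-! ### §1 Isolation of one term of a finite real sequence -/

section Isolation

variable {N : ℕ} {f : Fin N → ℝ}

/-- **Isolation.** If some term of `f` lies in `[a, b]`, every term of index `> k` is `< a` and every term of
index `< k` is `> b`, then the term in `[a, b]` is `f k`. [folklore] -/
theorem mem_Icc_of_exists_mem_of_isolated (k : Fin N) {a b : ℝ} (hex : ∃ j, f j ∈ Set.Icc a b)
    (hbelow : ∀ j, k < j → f j < a) (habove : ∀ j, j < k → b < f j) : f k ∈ Set.Icc a b := by
  obtain ⟨j, hj⟩ := hex
  rcases lt_trichotomy k j with h | h | h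
  · exact absurd hj.1 (not_le.2 (hbelow j h))
  · subst h
    exact hj
  · exact absurd hj.2 (not_le.2 (habove j h))

/-- Neighbour reduction, lower side: for an antitone `f`, `f (k+1) < a` already gives `f j < a` for every
`j > k`. [folklore] -/
theorem forall_lt_of_antitone_of_succ_lt (hf : Antitone f) {k j₁ : Fin N} (hj₁ : (j₁ : ℕ) = k + 1)
    {a : ℝ} (h : f j₁ < a) : ∀ j, k < j → f j < a := by
  intro j hj
  have hle : j₁ ≤ j := by
    rw [Fin.le_iff_val_le_val, hj₁]
    exact Nat.succ_le_of_lt (Fin.lt_def.1 hj)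
  exact (hf hle).trans_lt h

/-- Neighbour reduction, upper side: for an antitone `f`, `b < f (k−1)` already gives `b < f j` for every
`j < k`. [folklore] -/
theorem forall_gt_of_antitone_of_pred_gt (hf : Antitone f) {k j₀ : Fin N} (hj₀ : (k : ℕ) = j₀ + 1)
    {b : ℝ} (h : b < f j₀) : ∀ j, j < k → b < f j := by
  intro j hj
  have hle : j ≤ j₀ := by
    rw [Fin.le_iff_val_le_val]
    have := Fin.lt_def.1 hj
    omega
  exact h.trans_le (hf hle)

/-- If no index exceeds `k` (the last term) the lower-side hypothesis is vacuous; if `k` is the first index the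
upper-side hypothesis is vacuous — recorded for the top level `k = 0` of the antitone enumeration.
[folklore] -/
theorem forall_gt_of_val_eq_zero {k : Fin N} (hk : (k : ℕ) = 0) {b : ℝ} : ∀ j, j < k → b < f j := by
  intro j hj
  exact absurd (Fin.lt_def.1 hj) (by omega)

/-- Intersecting the certified ball with an a-priori box for the same term. [folklore] -/
theorem mem_Icc_max_min {k : Fin N} {a b lo hi : ℝ} (h : f k ∈ Set.Icc a b) (hbox : f k ∈ Set.Icc lo hi) :
    f k ∈ Set.Icc (max a lo) (min b hi) :=
  ⟨max_le h.1 hbox.1, le_min h.2 hbox.2⟩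

end Isolation

/-! ### §2 Weinstein's residual ball for `eigenvalues₀` at an arbitrary trial value -/

section Weinstein

variable {n : Type*} [Fintype n] [DecidableEq n] {A : Matrix n n ℝ}

/-- Weinstein's inequality for a real symmetric matrix in Mathlib's antitone enumeration `eigenvalues₀`: for
`x ≠ 0` and any trial value `μ`, some `|λ↓_j(A) − μ| · ‖x‖ ≤ ‖A x − μ x‖`.
[cite: HornJohnson2013, Thm 6.3.14] -/
theorem exists_abs_eigenvalues₀_sub_mul_norm_le (hA : A.IsHermitian) {x : n → ℝ} (hx : x ≠ 0) (μ : ℝ) :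
    ∃ j : Fin (Fintype.card n), |hA.eigenvalues₀ j - μ| * ‖toLp 2 x‖ ≤
      ‖toEuclideanLin A (toLp 2 x) - μ • toLp 2 x‖ := by
  have hT : (toEuclideanLin A).IsSymmetric := isSymmetric_toEuclideanLin_iff.mpr hA
  have hy : (toLp 2 x : EuclideanSpace ℝ n) ≠ 0 := fun h0 => hx ((toLp_eq_zero 2).1 h0)
  obtain ⟨j, hj⟩ := Literature.Analysis.InnerProduct.exists_abs_eigenvalues_sub_mul_norm_le hT
    finrank_euclideanSpace hy μ
  exact ⟨j, hj⟩

/-- **Residual ball.** `‖A x − μ x‖ ≤ ρ ‖x‖` with `x ≠ 0` ⇒ some `λ↓_j(A) ∈ [μ − ρ, μ + ρ]`.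
[cite: HornJohnson2013, Thm 6.3.14] -/
theorem exists_abs_eigenvalues₀_sub_le_of_norm_le (hA : A.IsHermitian) {x : n → ℝ} (hx : x ≠ 0)
    {μ ρ : ℝ} (h : ‖toEuclideanLin A (toLp 2 x) - μ • toLp 2 x‖ ≤ ρ * ‖toLp 2 x‖) :
    ∃ j : Fin (Fintype.card n), |hA.eigenvalues₀ j - μ| ≤ ρ := by
  obtain ⟨j, hj⟩ := exists_abs_eigenvalues₀_sub_mul_norm_le hA hx μ
  have hy : (toLp 2 x : EuclideanSpace ℝ n) ≠ 0 := fun h0 => hx ((toLp_eq_zero 2).1 h0)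
  exact ⟨j, le_of_mul_le_mul_right (hj.trans h) (norm_pos_iff.2 hy)⟩

/-- The residual norm in coordinates: `‖A x − μ x‖² = Σᵢ ((A x)ᵢ − μ xᵢ)²`. [folklore] -/
theorem norm_sq_residual_eq_sum (A : Matrix n n ℝ) (x : n → ℝ) (μ : ℝ) :
    ‖toEuclideanLin A (toLp 2 x) - μ • toLp 2 x‖ ^ 2 = ∑ i, ((A *ᵥ x) i - μ * x i) ^ 2 := by
  have h1 : toEuclideanLin A (toLp 2 x) - μ • toLp 2 x = toLp 2 (A *ᵥ x - μ • x) := by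
    rw [toLp_sub, toLp_smul]
    rfl
  rw [h1, EuclideanSpace.norm_sq_eq]
  refine Finset.sum_congr rfl fun i _ => ?_
  rw [Real.norm_eq_abs, sq_abs]
  rfl

omit [DecidableEq n] in
/-- `‖x‖² = Σᵢ xᵢ²` for the Euclidean norm of a real coordinate vector. [folklore] -/
theorem norm_sq_toLp_eq_sum (x : n → ℝ) : ‖(toLp 2 x : EuclideanSpace ℝ n)‖ ^ 2 = ∑ i, (x i) ^ 2 := by
  rw [EuclideanSpace.norm_sq_eq]
  refine Finset.sum_congr rfl fun i _ => ?_
  rw [Real.norm_eq_abs, sq_abs]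

/-- **Residual ball, checker shape** (no square roots): `Σᵢ ((A x)ᵢ − μ xᵢ)² ≤ ρ² Σᵢ xᵢ²`, `0 ≤ ρ`, `x ≠ 0`
⇒ some `|λ↓_j(A) − μ| ≤ ρ`. [cite: HornJohnson2013, Thm 6.3.14] -/
theorem exists_abs_eigenvalues₀_sub_le_of_sum_sq_le (hA : A.IsHermitian) {x : n → ℝ} (hx : x ≠ 0)
    {μ ρ : ℝ} (hρ : 0 ≤ ρ) (h : ∑ i, ((A *ᵥ x) i - μ * x i) ^ 2 ≤ ρ ^ 2 * ∑ i, (x i) ^ 2) :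
    ∃ j : Fin (Fintype.card n), |hA.eigenvalues₀ j - μ| ≤ ρ := by
  apply exists_abs_eigenvalues₀_sub_le_of_norm_le hA hx
  have h2 : ‖toEuclideanLin A (toLp 2 x) - μ • toLp 2 x‖ ^ 2 ≤ (ρ * ‖(toLp 2 x : EuclideanSpace ℝ n)‖) ^ 2 := by
    rw [norm_sq_residual_eq_sum, mul_pow, norm_sq_toLp_eq_sum]
    exact h
  exact (pow_le_pow_iff_left₀ (norm_nonneg _) (mul_nonneg hρ (norm_nonneg _)) two_ne_zero).1 h2

/-- **Matvec error.** If the APPLIED matrix `B` (character-truncated, float-assembled) has residual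
`‖B x − μ x‖ ≤ η ‖x‖` and the matvec error of the TRUE matrix is bounded, `‖(A − B) x‖ ≤ τ ‖x‖` (e.g. from an
operator-norm bound `‖A − B‖ ≤ τ`), then `‖A x − μ x‖ ≤ (η + τ) ‖x‖`. [folklore] -/
theorem residual_norm_le_of_approx {A B : Matrix n n ℝ} {x : n → ℝ} {μ η τ : ℝ}
    (hres : ‖toEuclideanLin B (toLp 2 x) - μ • toLp 2 x‖ ≤ η * ‖toLp 2 x‖)
    (hop : ‖toEuclideanLin (A - B) (toLp 2 x)‖ ≤ τ * ‖toLp 2 x‖) :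
    ‖toEuclideanLin A (toLp 2 x) - μ • toLp 2 x‖ ≤ (η + τ) * ‖toLp 2 x‖ := by
  have hsplit : toEuclideanLin A (toLp 2 x) - μ • toLp 2 x =
      (toEuclideanLin B (toLp 2 x) - μ • toLp 2 x) + toEuclideanLin (A - B) (toLp 2 x) := by
    rw [map_sub, LinearMap.sub_apply]
    abel
  rw [hsplit, add_mul]
  exact (norm_add_le _ _).trans (add_le_add hres hop)

/-- Matvec error in checker shape: `Σᵢ (((A − B) x)ᵢ)² ≤ τ² Σᵢ xᵢ²`, `0 ≤ τ` ⇒ `‖(A − B) x‖ ≤ τ ‖x‖`.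
[folklore] -/
theorem norm_apply_le_of_sum_sq_le (C : Matrix n n ℝ) (x : n → ℝ) {τ : ℝ} (hτ : 0 ≤ τ)
    (h : ∑ i, ((C *ᵥ x) i) ^ 2 ≤ τ ^ 2 * ∑ i, (x i) ^ 2) :
    ‖toEuclideanLin C (toLp 2 x)‖ ≤ τ * ‖(toLp 2 x : EuclideanSpace ℝ n)‖ := by
  have h2 : ‖toEuclideanLin C (toLp 2 x)‖ ^ 2 ≤ (τ * ‖(toLp 2 x : EuclideanSpace ℝ n)‖) ^ 2 := by
    have h0 := norm_sq_residual_eq_sum C x 0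
    simp only [zero_smul, sub_zero, zero_mul] at h0
    rw [h0, mul_pow, norm_sq_toLp_eq_sum]
    exact h
  exact (pow_le_pow_iff_left₀ (norm_nonneg _) (mul_nonneg hτ (norm_nonneg _)) two_ne_zero).1 h2

end Weinstein

/-! ### §3 The level certificate for a real symmetric matrix -/

section Level

variable {n : Type*} [Fintype n] [DecidableEq n] {A : Matrix n n ℝ}

/-- **LEVEL CERTIFICATE.** A residual ball `‖A x − μ x‖ ≤ ρ ‖x‖` (`x ≠ 0`) isolated by index — every
`λ↓_j(A)` with `j > k` certified `< μ − ρ` and every `λ↓_j(A)` with `j < k` certified `> μ + ρ` — encloses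
the `k`-th largest eigenvalue: `λ↓_k(A) ∈ [μ − ρ, μ + ρ]`. [cite: HornJohnson2013, Thm 6.3.14] -/
theorem eigenvalues₀_mem_Icc_of_residual_of_isolated (hA : A.IsHermitian) (k : Fin (Fintype.card n))
    {x : n → ℝ} (hx : x ≠ 0) {μ ρ : ℝ}
    (hres : ‖toEuclideanLin A (toLp 2 x) - μ • toLp 2 x‖ ≤ ρ * ‖toLp 2 x‖)
    (hbelow : ∀ j, k < j → hA.eigenvalues₀ j < μ - ρ)
    (habove : ∀ j, j < k → μ + ρ < hA.eigenvalues₀ j) :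
    hA.eigenvalues₀ k ∈ Set.Icc (μ - ρ) (μ + ρ) := by
  refine mem_Icc_of_exists_mem_of_isolated k ?_ hbelow habove
  obtain ⟨j, hj⟩ := exists_abs_eigenvalues₀_sub_le_of_norm_le hA hx hres
  exact ⟨j, by rw [Set.mem_Icc]; constructor <;> linarith [(abs_le.1 hj).1, (abs_le.1 hj).2]⟩

/-- **LEVEL CERTIFICATE, neighbour form.** Since `eigenvalues₀` is antitone, it suffices to certify the two
neighbours: `λ↓_{k+1}(A) < μ − ρ` (if `k + 1` is an index) and `μ + ρ < λ↓_{k−1}(A)` (if `k ≥ 1`).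
[cite: HornJohnson2013, Thm 6.3.14] -/
theorem eigenvalues₀_mem_Icc_of_residual_of_neighbours (hA : A.IsHermitian) (k : Fin (Fintype.card n))
    {x : n → ℝ} (hx : x ≠ 0) {μ ρ : ℝ}
    (hres : ‖toEuclideanLin A (toLp 2 x) - μ • toLp 2 x‖ ≤ ρ * ‖toLp 2 x‖)
    (hbelow : ∀ j₁ : Fin (Fintype.card n), (j₁ : ℕ) = k + 1 → hA.eigenvalues₀ j₁ < μ - ρ)
    (habove : ∀ j₀ : Fin (Fintype.card n), (k : ℕ) = j₀ + 1 → μ + ρ < hA.eigenvalues₀ j₀) :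
    hA.eigenvalues₀ k ∈ Set.Icc (μ - ρ) (μ + ρ) := by
  apply eigenvalues₀_mem_Icc_of_residual_of_isolated hA k hx hres
  · intro j hj
    have hk1 : (k : ℕ) + 1 < Fintype.card n :=
      lt_of_le_of_lt (Nat.succ_le_of_lt (Fin.lt_def.1 hj)) j.isLt
    exact forall_lt_of_antitone_of_succ_lt hA.eigenvalues₀_antitone (k := k) (j₁ := ⟨k + 1, hk1⟩) rfl
      (hbelow _ rfl) j hj
  · intro j hj
    have hjk := Fin.lt_def.1 hj
    have hk : (k : ℕ) - 1 < Fintype.card n := lt_of_le_of_lt (Nat.sub_le _ _) k.isLt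
    have hval : (k : ℕ) = ((⟨(k : ℕ) - 1, hk⟩ : Fin (Fintype.card n)) : ℕ) + 1 := by
      simp only
      omega
    exact forall_gt_of_antitone_of_pred_gt hA.eigenvalues₀_antitone hval (habove _ hval) j hj

/-- **Top level.** For `k = 0` only the lower neighbour needs a certificate: `λ↓_1(A) < μ − ρ` and a residual
ball give `λ↓_0(A) ∈ [μ − ρ, μ + ρ]` (the sector-top / vacuum use). [cite: HornJohnson2013, Thm 6.3.14] -/
theorem eigenvalues₀_zero_mem_Icc_of_residual (hA : A.IsHermitian) (k : Fin (Fintype.card n))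
    (hk : (k : ℕ) = 0) {x : n → ℝ} (hx : x ≠ 0) {μ ρ : ℝ}
    (hres : ‖toEuclideanLin A (toLp 2 x) - μ • toLp 2 x‖ ≤ ρ * ‖toLp 2 x‖)
    (hbelow : ∀ j, k < j → hA.eigenvalues₀ j < μ - ρ) :
    hA.eigenvalues₀ k ∈ Set.Icc (μ - ρ) (μ + ρ) :=
  eigenvalues₀_mem_Icc_of_residual_of_isolated hA k hx hres hbelow (forall_gt_of_val_eq_zero hk)

/-- Rayleigh quotient as the upper-side separator: `(μ + ρ)·yᵀy < yᵀAy` for some `y` certifies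
`μ + ρ < λ↓_0(A)` (Rayleigh, tree `KyFan.dotProduct_mulVec_le_eigenvalues₀_max_mul`); this is how the fine
run itself isolates its SECOND level (`k = 1`, the mass-gap level of the vacuum sector) from the top.
[cite: HornJohnson2013, Thm 4.2.2] -/
theorem lt_eigenvalues₀_zero_of_rayleigh (hA : A.IsHermitian) (j₀ : Fin (Fintype.card n))
    (hj₀ : (j₀ : ℕ) = 0) {y : n → ℝ} {c : ℝ} (hy : c * (y ⬝ᵥ y) < y ⬝ᵥ (A *ᵥ y)) :
    c < hA.eigenvalues₀ j₀ := by
  have hn : 1 ≤ Fintype.card n := by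
    have := j₀.isLt
    omega
  have hray := Literature.Analysis.Matrix.KyFan.dotProduct_mulVec_le_eigenvalues₀_max_mul hA hn y
  have hj : Fin.castLE hn 0 = j₀ := Fin.ext (by simp [hj₀])
  rw [hj] at hray
  have hyy : 0 < y ⬝ᵥ y := by
    rcases lt_or_ge 0 (y ⬝ᵥ y) with h | h
    · exact h
    · have h0 : y ⬝ᵥ y = 0 := le_antisymm h (by
        rw [dotProduct]; exact Finset.sum_nonneg fun i _ => mul_self_nonneg _)
      have hy0 : y = 0 := dotProduct_self_eq_zero.mp h0
      subst hy0
      simp at hy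
  exact lt_of_mul_lt_mul_right (hy.trans_le hray) hyy.le

/-- **Second level** (`k = 1`: the first excitation inside a symmetry sector, e.g. the mass-gap level of the
vacuum block): a residual ball for `(μ, x)`, a Rayleigh quotient `(μ + ρ)·yᵀy < yᵀAy` of a second trial vector
separating the top, and a certified `λ↓_2(A) < μ − ρ` give `λ↓_1(A) ∈ [μ − ρ, μ + ρ]`.
[cite: HornJohnson2013, Thm 6.3.14; Thm 4.2.2] -/
theorem eigenvalues₀_one_mem_Icc_of_residual_of_rayleigh (hA : A.IsHermitian) (k : Fin (Fintype.card n))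
    (hk : (k : ℕ) = 1) {x : n → ℝ} (hx : x ≠ 0) {μ ρ : ℝ}
    (hres : ‖toEuclideanLin A (toLp 2 x) - μ • toLp 2 x‖ ≤ ρ * ‖toLp 2 x‖)
    {y : n → ℝ} (hy : (μ + ρ) * (y ⬝ᵥ y) < y ⬝ᵥ (A *ᵥ y))
    (hbelow : ∀ j, k < j → hA.eigenvalues₀ j < μ - ρ) :
    hA.eigenvalues₀ k ∈ Set.Icc (μ - ρ) (μ + ρ) := by
  refine eigenvalues₀_mem_Icc_of_residual_of_isolated hA k hx hres hbelow (fun j hj => ?_)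
  have hj0 : (j : ℕ) = 0 := by
    have := Fin.lt_def.1 hj
    omega
  exact lt_eigenvalues₀_zero_of_rayleigh hA j hj0 hy

end Level

/-! ### §4 The chain for a K-weight kept-set compression (FLOW-DATA object `W`) -/

section Chain

open KWeightTail

variable {n : Type*} [Fintype n] [DecidableEq n] {V : Matrix n n ℝ}

/-- **MATRIX-FREE OBJECT-`W` ENCLOSURE.** `S = D V D` with `D = diag √K`, `V ⪰ 0`, kept set `p` with dropped
weights `≤ κ` and `uᵀVu ≤ Ω uᵀu`; `S_T = D_T V D_T` the kept-set compression.  If a trial pair `(μ, x)` for the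
FINE compression has residual `‖S_T x − μ x‖ ≤ ρ ‖x‖`, every `λ↓_j(S)` with `j > k` is certified `< μ − ρ`
(coarse certified upper ends of the OBJECT suffice, by `λ↓_j(S_T) ≤ λ↓_j(S)`), and every `λ↓_j(S_T)` with
`j < k` is certified `> μ + ρ` (e.g. Rayleigh–Ritz lower bounds of the fine run), then
`λ↓_k(S) ∈ [μ − ρ, μ + ρ + κ Ω]`. [cite: HornJohnson2013, Thm 6.3.14; Thm 4.3.1] -/
theorem full_eigenvalues₀_mem_Icc_of_compressed_residual (hV : V.PosSemidef) (K : n → ℝ) (p : n → Prop)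
    [DecidablePred p] {κ Ω : ℝ} (hK : ∀ i, 0 ≤ K i) (hκ : ∀ i, ¬ p i → K i ≤ κ) (hκ0 : 0 ≤ κ)
    (hΩ : ∀ u : n → ℝ, u ⬝ᵥ (V *ᵥ u) ≤ Ω * (u ⬝ᵥ u)) (k : Fin (Fintype.card n))
    {x : n → ℝ} (hx : x ≠ 0) {μ ρ : ℝ}
    (hres : ‖toEuclideanLin ((diagonal fun i => if p i then Real.sqrt (K i) else (0 : ℝ)) * V *
        (diagonal fun i => if p i then Real.sqrt (K i) else (0 : ℝ))) (toLp 2 x) - μ • toLp 2 x‖ ≤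
        ρ * ‖toLp 2 x‖)
    (hbelow : ∀ j, k < j → (isHermitian_full hV.isHermitian K).eigenvalues₀ j < μ - ρ)
    (habove : ∀ j, j < k → μ + ρ < (isHermitian_compressed hV.isHermitian K p).eigenvalues₀ j) :
    (isHermitian_full hV.isHermitian K).eigenvalues₀ k ∈ Set.Icc (μ - ρ) (μ + ρ + κ * Ω) := by
  have hT : (isHermitian_compressed hV.isHermitian K p).eigenvalues₀ k ∈ Set.Icc (μ - ρ) (μ + ρ) := by
    refine eigenvalues₀_mem_Icc_of_residual_of_isolated (isHermitian_compressed hV.isHermitian K p) k hx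
      hres (fun j hj => ?_) habove
    exact (eigenvalues₀_compressed_le hV K p hK j).trans_lt (hbelow j hj)
  have h := eigenvalues₀_mem_Icc hV K p hK hκ hκ0 hΩ k
  exact ⟨hT.1.trans h.1, h.2.trans (by linarith [hT.2])⟩

/-- **Top level of a sector** (`k = 0`: the vacuum / flux-sector top that gives `λ̂₀` and the torelon
energies): a fine residual ball and a certified `λ↓_1(S) < μ − ρ` give `λ↓_0(S) ∈ [μ − ρ, μ + ρ + κ Ω]`.
[cite: HornJohnson2013, Thm 6.3.14; Thm 4.3.1] -/
theorem full_eigenvalues₀_zero_mem_Icc_of_compressed_residual (hV : V.PosSemidef) (K : n → ℝ)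
    (p : n → Prop) [DecidablePred p] {κ Ω : ℝ} (hK : ∀ i, 0 ≤ K i) (hκ : ∀ i, ¬ p i → K i ≤ κ)
    (hκ0 : 0 ≤ κ) (hΩ : ∀ u : n → ℝ, u ⬝ᵥ (V *ᵥ u) ≤ Ω * (u ⬝ᵥ u)) (k : Fin (Fintype.card n))
    (hk : (k : ℕ) = 0) {x : n → ℝ} (hx : x ≠ 0) {μ ρ : ℝ}
    (hres : ‖toEuclideanLin ((diagonal fun i => if p i then Real.sqrt (K i) else (0 : ℝ)) * V *
        (diagonal fun i => if p i then Real.sqrt (K i) else (0 : ℝ))) (toLp 2 x) - μ • toLp 2 x‖ ≤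
        ρ * ‖toLp 2 x‖)
    (hbelow : ∀ j, k < j → (isHermitian_full hV.isHermitian K).eigenvalues₀ j < μ - ρ) :
    (isHermitian_full hV.isHermitian K).eigenvalues₀ k ∈ Set.Icc (μ - ρ) (μ + ρ + κ * Ω) :=
  full_eigenvalues₀_mem_Icc_of_compressed_residual hV K p hK hκ hκ0 hΩ k hx hres hbelow
    (forall_gt_of_val_eq_zero hk)

/-- **Variant with coarse lower ends.** The upper-side isolation may also be read off certified LOWER ends of
the object: `μ + ρ + κ Ω < λ↓_j(S)` for `j < k` gives `μ + ρ < λ↓_j(S_T)` by the upper half of the tail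
theorem. [cite: HornJohnson2013, Thm 6.3.14; Thm 4.3.1] -/
theorem full_eigenvalues₀_mem_Icc_of_compressed_residual_of_full_lower (hV : V.PosSemidef) (K : n → ℝ)
    (p : n → Prop) [DecidablePred p] {κ Ω : ℝ} (hK : ∀ i, 0 ≤ K i) (hκ : ∀ i, ¬ p i → K i ≤ κ)
    (hκ0 : 0 ≤ κ) (hΩ : ∀ u : n → ℝ, u ⬝ᵥ (V *ᵥ u) ≤ Ω * (u ⬝ᵥ u)) (k : Fin (Fintype.card n))
    {x : n → ℝ} (hx : x ≠ 0) {μ ρ : ℝ}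
    (hres : ‖toEuclideanLin ((diagonal fun i => if p i then Real.sqrt (K i) else (0 : ℝ)) * V *
        (diagonal fun i => if p i then Real.sqrt (K i) else (0 : ℝ))) (toLp 2 x) - μ • toLp 2 x‖ ≤
        ρ * ‖toLp 2 x‖)
    (hbelow : ∀ j, k < j → (isHermitian_full hV.isHermitian K).eigenvalues₀ j < μ - ρ)
    (habove : ∀ j, j < k → μ + ρ + κ * Ω < (isHermitian_full hV.isHermitian K).eigenvalues₀ j) :
    (isHermitian_full hV.isHermitian K).eigenvalues₀ k ∈ Set.Icc (μ - ρ) (μ + ρ + κ * Ω) := by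
  refine full_eigenvalues₀_mem_Icc_of_compressed_residual hV K p hK hκ hκ0 hΩ k hx hres hbelow
    (fun j hj => ?_)
  have h := eigenvalues₀_le_compressed_add hV K p hK hκ hκ0 hΩ j
  linarith [habove j hj]

end Chain

end MatrixFreeLevel

end Summit.Ventures.YMGap.FlowData

end
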